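import Literature.AlgebraicGeometry.Frobenioids.ProfiniteUnitsDecomposition
import HarnessLib

/-!
# Frobenioids I, Definition 2.8: automatic continuity and naturality of the `ζ`-th power maps — proofs

Mochizuki, *The geometry of Frobenioids I*, Kyushu J. Math. **62** (2008), §2, kurims pp. 52–55
[cite: MochizukiFrdI2008, Def. 2.8(iii) p.52].  The proof of Prop. 2.9 (ii) (p. 54, last lines)
uses that "raising to the `ζ`-th power defines an endomorphism of the functor in monoids `O^×(−)`
on `C^lin` which commutes with raising to the `d`-th power, for `d ∈ ℕ_{≥1}`".  This file supplies the
underlying group theory over `ProfiniteUnitsProofs` / `ProfiniteUnitsDecomposition`: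

* `IsTfgProfinite.continuous_monoidHom` — every abstract homomorphism between topologically
  finitely generated profinite abelian groups is continuous (finite-index subgroups are open);
* `IsTfgProfinite.map_mem_proL` — such homomorphisms map `M[l]` into `N[l]`;
* `IsTfgProfinite.map_zetaPowerMap` — they commute with the maps "raising to the `ζ`-th power"
  (Def. 2.8 (iii)); in particular the `ζ`-th power map commutes with every `d`-th power map.

Part of the dossier for Prop. 2.9 (ii) (deep-pool item D-δ-2 of the abc-iut cell).  No new
definitions (theorems only).
-/

namespace Literature.AlgebraicGeometry.Frobenioids

open _root_.Topology Filter

universe u u'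

namespace IsTfgProfinite

variable {M : Type u} [CommGroup M] [TopologicalSpace M]
  {N : Type u'} [CommGroup N] [TopologicalSpace N]

/-- **Automatic continuity.**  A group homomorphism between topologically finitely generated
profinite abelian groups is continuous: the preimage of an open subgroup has finite index, hence is
open (`isOpen_of_finiteIndex`), and open subgroups form a neighbourhood basis of `1`.
[cite: MochizukiFrdI2008, Def. 2.8(i) p.52] -/
theorem continuous_monoidHom (hM : IsTfgProfinite M) (hN : IsTfgProfinite N) (h : M →* N) :
    Continuous h := by
  haveI := hM.isTopologicalGroup
  haveI := hN.isTopologicalGroup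
  refine continuous_of_continuousAt_one h ?_
  rw [ContinuousAt, map_one, tendsto_def]
  intro W hW
  obtain ⟨U, hU⟩ := hN.exists_openSubgroup_subset hW
  have hidx : ((U : Subgroup N).comap h).index ≠ 0 := by
    have hrel : (U : Subgroup N).relIndex ⊤ ≠ 0 := by
      rw [Subgroup.relIndex_top_right]
      exact hN.index_ne_zero U
    have := Subgroup.relIndex_comap_ne_zero h (K := ⊤) hrel
    rwa [Subgroup.comap_top, Subgroup.relIndex_top_right] at this
  haveI : ((U : Subgroup N).comap h).FiniteIndex := ⟨hidx⟩
  exact Filter.mem_of_superset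
    ((hM.isOpen_of_finiteIndex ((U : Subgroup N).comap h)).mem_nhds (Subgroup.one_mem _))
    fun x hx => hU (Subgroup.mem_comap.mp hx)

/-- A continuous homomorphism maps the pro-`l` portion `M[l]` into `N[l]`.
[cite: MochizukiFrdI2008, Def. 2.8(ii) p.52] -/
theorem map_mem_proL (h : M →* N) (hc : Continuous h) {l : Nat.Primes} {y : M}
    (hy : y ∈ proL M l) : h y ∈ proL N l := by
  rw [mem_proL_iff] at hy ⊢
  intro U
  obtain ⟨n, hn⟩ := hy (U.comap h hc)
  exact ⟨n, by simpa [map_pow] using hn⟩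

/-- **Naturality of the `ζ`-th power maps.**  For topologically finitely generated profinite abelian
groups `M`, `N`, maps `f_M`, `f_N` "raising to the `ζ`-th power" (Def. 2.8 (iii)) and ANY
homomorphism `h : M → N`: `h ∘ f_M = f_N ∘ h`.  (Automatic continuity; `h` preserves the pro-`l`
portions, on which both sides are `y ↦ h(y)^{ζ(l)}`; conclude by the convergent decomposition
`x = ∏'_l x_l` of Def. 2.8 (ii).)  With `N = M`, `h = (·)^d` this is the commutation with `d`-th
powers used in the proof of Prop. 2.9 (ii). [cite: MochizukiFrdI2008, Prop. 2.9(ii) p.54] -/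
theorem map_zetaPowerMap (hM : IsTfgProfinite M) (hN : IsTfgProfinite N) {ζ : Nat.Primes → ℕ+}
    {fM : M → M} {fN : N → N} (hfM : IsZetaPowerMap M ζ fM) (hfN : IsZetaPowerMap N ζ fN)
    (h : M →* N) (x : M) : h (fM x) = fN (h x) := by
  classical
  haveI := hN.t2Space
  have hc : Continuous h := hM.continuous_monoidHom hN h
  obtain ⟨c, ⟨hcmem, hcm, hcx⟩, -⟩ := ProLDecomposition_holds M hM x
  have hcp : HasProd c x := hcx ▸ hcm.hasProd
  let FM : M →* M := MonoidHom.mk' fM hfM.map_mul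
  let FN : N →* N := MonoidHom.mk' fN hfN.map_mul
  have h1 : HasProd ((h.comp FM) ∘ c) (h (fM x)) := hcp.map (h.comp FM) (hc.comp hfM.continuous)
  have h2 : HasProd ((FN.comp h) ∘ c) (fN (h x)) := hcp.map (FN.comp h) (hfN.continuous.comp hc)
  have heq : (h.comp FM) ∘ c = (FN.comp h) ∘ c := by
    funext l
    simp only [Function.comp_apply, MonoidHom.coe_comp, FM, FN, MonoidHom.mk'_apply]
    rw [hfM.eq_pow l (c l) (hcmem l), hfN.eq_pow l (h (c l)) (map_mem_proL h hc (hcmem l)),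
      map_pow]
  rw [heq] at h1
  exact h1.unique h2

end IsTfgProfinite

end Literature.AlgebraicGeometry.Frobenioids
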